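import Mathlib
import HarnessLib
import Summits.FinalStateConjecture.FinalStateConjecture.Theorems.LogTimeThreeAnnuliDyadicCaptureFrozenMemberUnique
import Summits.FinalStateConjecture.FinalStateConjecture.Theorems.LogTimeThreeAnnuliDyadicCaptureFreezingD
import Summits.FinalStateConjecture.FinalStateConjecture.Theorems.LogTimeThreeAnnuliDyadicCaptureKerrSchildJets

/-!
# Route LogTimeThreeAnnuli · crux `DyadicCapture` · line `registered` — capture upgrade, part A

Parameter capture WITHOUT summability (lead c3, skeleton v6 of the line). Setting: a chart `Ψ` on a
reference boosted Kerr exterior `boostedKerrExterior Λ c M' a'` (`0 < M'`), the compact window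
`W = {m₀ ≤ M ≤ 1/m₀, |a| ≤ χM}` of members `g_p = boostedKerrBilin Λ c p.1 p.2`, all deviations measured
in the reference background with only the field replaced (`{boostedKerrBackground Λ c M' a' with bilin := g_p}`).

* `captureA_rigidityModulus` — the rigidity MODULUS of the family at the boosted anchor `x₀ = c + Λy₀`:
  for every `θ > 0` there is `η > 0` such that a window member whose value at `x₀` is `η`-close to that
  of the reference member `p∞ = (M', a')` is `θ`-close to `p∞` (compact window, continuity and
  injectivity of `p ↦ g_p(x₀)` on `{M > 0}`: `freezing_continuous_boosted_param`,
  `freezing_anchor_injective`).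
* `captureA_dist_lt_of_le` — hence a window member `p` and the reference member that are both `η`-close
  in `C⁰` to `Ψ^* g` on the anchor slab `{t* = τ, r ≤ r(y₀)}` at ONE time `τ` are `θ`-close
  (stationarity: `freezing_enorm_anchor_sub_le`).
* `captureA_mem_window` — if window members come `C⁰`-arbitrarily close to `Ψ^* g` on the anchor slab
  at arbitrarily late times and the reference member is the `C⁰` limit there, then `p∞ ∈ W`.
* `captureA_continuousAt_jets₂` — JOINT continuity of `((M, a), y) ↦ Dᵐ_y g_{M,a}(y)` off the discs
  (joint smoothness `dyadicCapture_contDiffAt_boostedKerrBilin₃` and the slice formula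
  `dyadicCapture_iteratedFDeriv_slice_eq`).
* `captureA_radius_pos_of_sq_lt` — members with `α² < a'² + r₀²` have positive rest-frame radius
  wherever `r_{a'} ≥ r₀ > 0` (closed form of the disc exclusion `freezing_radius_pos_of_sq_le`).

Sources: Kerr–Schild 1965 §2 (the explicit stationary family); DHRT arXiv:2104.08222 §1 (the norms).
-/

-- the `Summit.FinalStateConjecture.FinalStateConjecture.…` namespace repeats the summit = sub-problem
-- segment (D-0017 layout, CONVENTIONS §2); the duplicate is deliberate.
set_option linter.dupNamespace false

noncomputable section

namespace Summit.FinalStateConjecture.FinalStateConjecture.Theorems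

open Literature.Geometry.Lorentzian
open scoped Topology Manifold ENNReal ContDiff
open Filter Set

/-! ### Small facts -/

/-- **Closed disc exclusion**: if `r_{a'}(z) ≥ r₀ > 0` and `α² < a'² + r₀²` then `r_α(z) > 0`
(a zero of `r_α` lies on the disc `{z₃ = 0, ρ² ≤ α²}`, where `r_{a'}² = max(ρ² − a'², 0)`;
Visser arXiv:0706.0622, (35)). [cite: arXiv07060622, (35)] -/
theorem captureA_radius_pos_of_sq_lt {a' α r₀ : ℝ} {z : E4} (hr₀ : 0 < r₀) (hz : r₀ ≤ Kerr.radius a' z)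
    (hα : α ^ 2 < a' ^ 2 + r₀ ^ 2) : 0 < Kerr.radius α z := by
  rcases (Kerr.radius_nonneg α z).lt_or_eq with h | h
  · exact h
  · exfalso
    obtain ⟨h3, hρ⟩ := freezing_three_eq_zero_of_radius_eq_zero α h.symm
    have hsq := freezing_radius_sq_of_three_eq_zero a' h3
    have hle : r₀ ^ 2 ≤ Kerr.radius a' z ^ 2 := pow_le_pow_left₀ hr₀.le hz 2
    rw [hsq] at hle
    have hpos : 0 < r₀ ^ 2 := by positivity
    have hmax : max (E4.spatialNorm z ^ 2 - a' ^ 2) 0 = E4.spatialNorm z ^ 2 - a' ^ 2 := by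
      refine max_eq_left ?_
      by_contra hneg
      push Not at hneg
      rw [max_eq_right hneg.le] at hle
      linarith
    rw [hmax] at hle
    linarith

/-- The truncated deviation is monotone in the order `k` (`supCkENorm_mono_right`). [folklore] -/
theorem captureA_truncDeviationCk_mono_k {𝓢 : Spacetime.{0} 4} (B : ModelBackground)
    (Ψ : B.domain → 𝓢.carrier) {k k' : ℕ} (h : k ≤ k') (R τ : ℝ) :
    𝓢.truncDeviationCk B Ψ k R τ ≤ 𝓢.truncDeviationCk B Ψ k' R τ :=
  supCkENorm_mono_right _ h _

/-! ### The rigidity modulus of the family at the anchor -/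

section Anchor

variable (Λ : lorentzGroup) (c : E4)

-- the algebraic and the operator-norm instance paths on `E4 →L[ℝ] E4 →L[ℝ] ℝ` unify slowly
set_option synthInstance.maxHeartbeats 200000 in
set_option maxHeartbeats 800000 in
/-- **Rigidity modulus at the anchor.** Let `y₀` be an anchor (`y₀ 1 = 0`, `y₀ 2, y₀ 3 ≠ 0`),
`x₀ = c + Λy₀`, `W` the compact window and `p∞` a member of `{M > 0}`. For every `θ > 0` there is
`η > 0` such that every `p ∈ W` with `‖g_p(x₀) − g_{p∞}(x₀)‖ < η` satisfies `dist p p∞ < θ`: on the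
compact set `W ∩ {dist ≥ θ}` the continuous function `p ↦ ‖g_p(x₀) − g_{p∞}(x₀)‖` is positive
(injectivity at the anchor, `freezing_anchor_injective`), hence bounded below. [cite: KerrSchild1965, §2] -/
theorem captureA_rigidityModulus {y₀ : E4} (h1 : y₀ 1 = 0) (h2 : y₀ 2 ≠ 0) (h3 : y₀ 3 ≠ 0) {m₀ : ℝ}
    (χ : ℝ) (hm₀ : 0 < m₀) {pinf : ℝ × ℝ} (hpinf : 0 < pinf.1) {θ : ℝ} (hθ : 0 < θ) :
    ∃ η : ℝ, 0 < η ∧ ∀ p ∈ {q : ℝ × ℝ | m₀ ≤ q.1 ∧ q.1 ≤ m₀⁻¹ ∧ |q.2| ≤ χ * q.1},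
      ‖boostedKerrBilin Λ c p.1 p.2 (c + (Λ : E4 ≃L[ℝ] E4) y₀) -
          boostedKerrBilin Λ c pinf.1 pinf.2 (c + (Λ : E4 ≃L[ℝ] E4) y₀)‖ < η →
        dist p pinf < θ := by
  set W := {q : ℝ × ℝ | m₀ ≤ q.1 ∧ q.1 ≤ m₀⁻¹ ∧ |q.2| ≤ χ * q.1} with hW
  set G : ℝ × ℝ → E4 →L[ℝ] E4 →L[ℝ] ℝ :=
    fun q ↦ boostedKerrBilin Λ c q.1 q.2 (c + (Λ : E4 ≃L[ℝ] E4) y₀) with hG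
  have hGc : Continuous G := by
    refine freezing_continuous_boosted_param fun α ↦ ?_
    rw [freezing_poincareInv_boost]
    exact kerrSchildRigidity_radius_pos α h3
  set S : Set (ℝ × ℝ) := W ∩ {q | θ ≤ dist q pinf} with hS
  have hSc : IsCompact S :=
    (freezing_isCompact_window m₀ χ).inter_right
      (isClosed_le continuous_const (continuous_id.dist continuous_const))
  rcases S.eq_empty_or_nonempty with hSe | hSne
  · refine ⟨1, one_pos, fun p hp _ ↦ ?_⟩
    by_contra hd
    push Not at hd
    have : p ∈ S := ⟨hp, hd⟩
    rw [hSe] at this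
    exact this
  · set f : ℝ × ℝ → ℝ := fun q ↦ dist (G q) (G pinf) with hf
    have hfc : Continuous f := hGc.dist continuous_const
    obtain ⟨q₀, hq₀S, hmin⟩ := hSc.exists_isMinOn hSne hfc.continuousOn
    have hfq₀ : 0 < f q₀ := by
      rcases (dist_nonneg (x := G q₀) (y := G pinf)).lt_or_eq with h | h
      · exact h
      · exfalso
        have hGeq : G q₀ = G pinf := dist_eq_zero.1 h.symm
        have hq₀pos : 0 < q₀.1 := hm₀.trans_le hq₀S.1.1
        have heq : q₀ = pinf := freezing_anchor_injective h1 h2 h3 hq₀pos hpinf hGeq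
        have : θ ≤ dist q₀ pinf := hq₀S.2
        rw [heq, dist_self] at this
        exact absurd this (not_le.2 hθ)
    refine ⟨f q₀, hfq₀, fun p hp hlt ↦ ?_⟩
    have hd' : dist (G p) (G pinf) = ‖G p - G pinf‖ := dist_eq_norm (G p) (G pinf)
    have hlt' : f p < f q₀ := by
      show dist (G p) (G pinf) < f q₀
      rw [hd']
      exact hlt
    by_contra hd
    push Not at hd
    have hpS : p ∈ S := ⟨hp, hd⟩
    have hle : f q₀ ≤ f p := hmin hpS
    exact absurd hlt' (not_lt.2 hle)

end Anchor

/-! ### Capture of the window parameters by the reference member -/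

section Chart

variable {𝓢 : Spacetime.{0} 4} (Λ : lorentzGroup) (c : E4) (M' a' : ℝ)
  (Ψ : (boostedKerrExterior Λ c M' a') → 𝓢.carrier)

-- the structure-update backgrounds unfold slowly
set_option synthInstance.maxHeartbeats 200000 in
set_option maxHeartbeats 800000 in
/-- **Anchor comparison at one time.** For two members `p, q` and every `τ`, the constant
`‖g_p(x₀) − g_q(x₀)‖` at the boosted anchor `x₀ = c + Λy₀` (`y₀ 0 = 0`, `y₀` in the reference exterior)
is at most the sum of the two truncated `C⁰` deviations at time `τ` on the slab of radius `r_{a'}(y₀)`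
(stationarity along the Killing orbit, `freezing_enorm_anchor_sub_le`). [cite: KerrSchild1965, §2] -/
theorem captureA_enorm_anchor_sub_le_trunc {y₀ : E4} (h0 : y₀ 0 = 0)
    (hy₀ : max (Kerr.rPlus M' a') 0 < Kerr.radius a' y₀) (p q : ℝ × ℝ) (τ : ℝ) :
    ‖boostedKerrBilin Λ c p.1 p.2 (c + (Λ : E4 ≃L[ℝ] E4) y₀) -
        boostedKerrBilin Λ c q.1 q.2 (c + (Λ : E4 ≃L[ℝ] E4) y₀)‖ₑ ≤
      𝓢.truncDeviationCk ({boostedKerrBackground Λ c M' a' with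
          bilin := boostedKerrBilin Λ c p.1 p.2} : ModelBackground) Ψ 0 (Kerr.radius a' y₀) τ +
        𝓢.truncDeviationCk ({boostedKerrBackground Λ c M' a' with
          bilin := boostedKerrBilin Λ c q.1 q.2} : ModelBackground) Ψ 0 (Kerr.radius a' y₀) τ := by
  have hx₀U : c + (Λ : E4 ≃L[ℝ] E4) y₀ ∈ (boostedKerrExterior Λ c M' a' : Set E4) :=
    freezing_boost_mem_exterior hy₀
  have hpt : ∀ q' : ℝ × ℝ,
      ‖𝓢.deviationExtend ({boostedKerrBackground Λ c M' a' with
          bilin := boostedKerrBilin Λ c q'.1 q'.2} : ModelBackground) Ψ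
        ((c + (Λ : E4 ≃L[ℝ] E4) y₀) + τ • (Λ : E4 ≃L[ℝ] E4) (EuclideanSpace.single (0 : Fin 4) (1 : ℝ)))‖ₑ ≤
      𝓢.truncDeviationCk ({boostedKerrBackground Λ c M' a' with
          bilin := boostedKerrBilin Λ c q'.1 q'.2} : ModelBackground) Ψ 0 (Kerr.radius a' y₀) τ := by
    intro q'
    have hj := freezing_enorm_iteratedFDeriv_le_truncDeviationCk (𝓢 := 𝓢) (boostedKerrBackground Λ c M' a')
      Ψ (boostedKerrBilin Λ c q'.1 q'.2) (Nat.zero_le 0)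
      (frozenMemberUnique_translate_mem_slab Λ c M' a' (boostedKerrBilin Λ c q'.1 q'.2) h0 hy₀ τ)
    rwa [freezing_enorm_iteratedFDeriv_zero] at hj
  exact (freezing_enorm_anchor_sub_le Λ c M' a' Ψ hx₀U p q τ).trans (add_le_add (hpt p) (hpt q))

-- the structure-update backgrounds unfold slowly
set_option synthInstance.maxHeartbeats 200000 in
set_option maxHeartbeats 1600000 in
/-- **Capture at one time.** Let `0 < M'`, `p∞ = (M', a')`, `W` the window, `y₀` an anchor of the
reference exterior. For every `θ > 0` there is `η > 0` such that for every time `τ` and every `p ∈ W`: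
if `g_p` and `g_{p∞}` are both `η`-close in `C⁰` to `Ψ^* g` on the anchor slab `{t* = τ, r ≤ r(y₀)}`, then
`dist p p∞ < θ`. [cite: KerrSchild1965, §2] -/
theorem captureA_dist_lt_of_le (hM' : 0 < M') {y₀ : E4} (h0 : y₀ 0 = 0) (h1 : y₀ 1 = 0) (h2 : y₀ 2 ≠ 0)
    (h3 : y₀ 3 ≠ 0) (hy₀ : max (Kerr.rPlus M' a') 0 < Kerr.radius a' y₀) {m₀ : ℝ} (χ : ℝ) (hm₀ : 0 < m₀)
    {θ : ℝ} (hθ : 0 < θ) :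
    ∃ η : ℝ, 0 < η ∧ ∀ (τ : ℝ), ∀ p ∈ {q : ℝ × ℝ | m₀ ≤ q.1 ∧ q.1 ≤ m₀⁻¹ ∧ |q.2| ≤ χ * q.1},
      𝓢.truncDeviationCk ({boostedKerrBackground Λ c M' a' with
          bilin := boostedKerrBilin Λ c p.1 p.2} : ModelBackground) Ψ 0 (Kerr.radius a' y₀) τ ≤
        ENNReal.ofReal η →
      𝓢.truncDeviationCk ({boostedKerrBackground Λ c M' a' with
          bilin := boostedKerrBilin Λ c M' a'} : ModelBackground) Ψ 0 (Kerr.radius a' y₀) τ ≤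
        ENNReal.ofReal η →
      dist p (M', a') < θ := by
  obtain ⟨η, hη, hmod⟩ := captureA_rigidityModulus Λ c h1 h2 h3 χ hm₀ (pinf := (M', a')) hM' hθ
  refine ⟨η / 3, by positivity, fun τ p hp hP hQ ↦ hmod p hp ?_⟩
  have hle := captureA_enorm_anchor_sub_le_trunc Λ c M' a' Ψ h0 hy₀ p (M', a') τ
  have hsum : ‖boostedKerrBilin Λ c p.1 p.2 (c + (Λ : E4 ≃L[ℝ] E4) y₀) -
      boostedKerrBilin Λ c M' a' (c + (Λ : E4 ≃L[ℝ] E4) y₀)‖ₑ ≤ ENNReal.ofReal (η / 3 + η / 3) := by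
    rw [ENNReal.ofReal_add (by positivity) (by positivity)]
    exact hle.trans (add_le_add hP hQ)
  rw [← ofReal_norm] at hsum
  have hr := (ENNReal.ofReal_le_ofReal_iff (by positivity : (0 : ℝ) ≤ η / 3 + η / 3)).1 hsum
  exact lt_of_le_of_lt hr (by linarith)

-- the structure-update backgrounds unfold slowly
set_option synthInstance.maxHeartbeats 200000 in
set_option maxHeartbeats 1600000 in
/-- **The reference member lies in the window.** If for every `ε > 0` window members `ε`-close in `C⁰`
to `Ψ^* g` on the anchor slab exist at arbitrarily late times (eventually in `τ`), and the reference
member `p∞ = (M', a')`, `0 < M'`, is the `C⁰` limit of `Ψ^* g` on that slab, then `p∞ ∈ W` (the window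
is closed and `p∞` is captured at every scale, `captureA_dist_lt_of_le`). [cite: KerrSchild1965, §2] -/
theorem captureA_mem_window (hM' : 0 < M') {y₀ : E4} (h0 : y₀ 0 = 0) (h1 : y₀ 1 = 0) (h2 : y₀ 2 ≠ 0)
    (h3 : y₀ 3 ≠ 0) (hy₀ : max (Kerr.rPlus M' a') 0 < Kerr.radius a' y₀) {m₀ χ : ℝ} (hm₀ : 0 < m₀)
    (hW0 : ∀ ε : ℝ≥0∞, 0 < ε → ∀ᶠ τ : ℝ in atTop, ∃ p ∈ {q : ℝ × ℝ | m₀ ≤ q.1 ∧ q.1 ≤ m₀⁻¹ ∧ |q.2| ≤ χ * q.1},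
      𝓢.truncDeviationCk ({boostedKerrBackground Λ c M' a' with
          bilin := boostedKerrBilin Λ c p.1 p.2} : ModelBackground) Ψ 0 (Kerr.radius a' y₀) τ ≤ ε)
    (hN : Tendsto (fun τ : ℝ ↦ 𝓢.truncDeviationCk ({boostedKerrBackground Λ c M' a' with
          bilin := boostedKerrBilin Λ c M' a'} : ModelBackground) Ψ 0 (Kerr.radius a' y₀) τ)
      atTop (𝓝 0)) :
    ((M', a') : ℝ × ℝ) ∈ {q : ℝ × ℝ | m₀ ≤ q.1 ∧ q.1 ≤ m₀⁻¹ ∧ |q.2| ≤ χ * q.1} := by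
  have hWc : IsClosed {q : ℝ × ℝ | m₀ ≤ q.1 ∧ q.1 ≤ m₀⁻¹ ∧ |q.2| ≤ χ * q.1} :=
    (freezing_isCompact_window m₀ χ).isClosed
  rw [← hWc.closure_eq, Metric.mem_closure_iff]
  intro θ hθ
  obtain ⟨η, hη, hcap⟩ := captureA_dist_lt_of_le Λ c M' a' Ψ hM' h0 h1 h2 h3 hy₀ χ hm₀ hθ
  have hε : (0 : ℝ≥0∞) < ENNReal.ofReal η := ENNReal.ofReal_pos.2 hη
  have hev := (hW0 (ENNReal.ofReal η) hε).and (ENNReal.tendsto_nhds_zero.1 hN (ENNReal.ofReal η) hε)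
  obtain ⟨τ, ⟨p, hp, hP⟩, hQ⟩ := hev.exists
  refine ⟨p, hp, ?_⟩
  rw [dist_comm]
  exact hcap τ p hp hP hQ

end Chart

/-! ### Joint continuity of the jets of the family -/

/-- **The `y`-jets of the boosted Kerr–Schild family are JOINTLY continuous in `((M, a), y)` off the
discs**: at every `((M, a), y)` with `r_a(Λ⁻¹(y − c)) > 0` the map
`((M, a), y) ↦ Dᵐ_y (boostedKerrBilin Λ c M a)(y)` is continuous (the family is jointly smooth on the
open set `{r_a(Λ⁻¹(y − c)) > 0}`, `dyadicCapture_contDiffAt_boostedKerrBilin₃`; there the slice jet is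
the joint jet composed with `inr`, `dyadicCapture_iteratedFDeriv_slice_eq`, Dieudonné 1960 (8.12.8)).
[cite: KerrSchild1965, §2] -/
theorem captureA_continuousAt_jets₂ (Λ : lorentzGroup) (c : E4) (m : ℕ) {q₀ : (ℝ × ℝ) × E4}
    (hq₀ : 0 < Kerr.radius q₀.1.2 (poincareInv Λ c q₀.2)) :
    ContinuousAt (fun q : (ℝ × ℝ) × E4 ↦ iteratedFDeriv ℝ m (boostedKerrBilin Λ c q.1.1 q.1.2) q.2) q₀ := by
  set O : Set ((ℝ × ℝ) × E4) := {q | 0 < Kerr.radius q.1.2 (poincareInv Λ c q.2)} with hO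
  have hOo : IsOpen O := by
    refine isOpen_lt continuous_const ?_
    unfold Kerr.radius E4.spatialNorm poincareInv
    fun_prop
  set g : (ℝ × ℝ) × E4 → E4 →L[ℝ] E4 →L[ℝ] ℝ := fun q ↦ boostedKerrBilin Λ c q.1.1 q.1.2 q.2 with hg
  have hcd : ContDiffOn ℝ ∞ g O :=
    fun q hq ↦ (dyadicCapture_contDiffAt_boostedKerrBilin₃ Λ c hq).contDiffWithinAt
  have hq₀O : q₀ ∈ O := hq₀
  -- on `O` the slice jet is the joint jet composed with `inr`
  have heq : (fun q : (ℝ × ℝ) × E4 ↦ iteratedFDeriv ℝ m (boostedKerrBilin Λ c q.1.1 q.1.2) q.2) =ᶠ[𝓝 q₀]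
      fun q ↦ (iteratedFDeriv ℝ m g q).compContinuousLinearMap
        fun _ ↦ ContinuousLinearMap.inr ℝ (ℝ × ℝ) E4 := by
    filter_upwards [hOo.mem_nhds hq₀O] with q hq
    have h := dyadicCapture_iteratedFDeriv_slice_eq (g := g) hOo hcd (θ₀ := q.1) (ξ₀ := q.2) hq
      (i := m) (by exact_mod_cast le_top)
    exact h
  refine ContinuousAt.congr ?_ heq.symm
  have h1 : ContinuousAt (iteratedFDeriv ℝ m g) q₀ :=
    ((dyadicCapture_contDiffAt_boostedKerrBilin₃ Λ c (q := q₀) (n := ∞) hq₀).continuousAt_iteratedFDeriv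
      (by exact_mod_cast le_top))
  exact (ContinuousMultilinearMap.continuous_precomp _).continuousAt.comp h1

/-- **Part A, registered form** (`captureA_radius_pos`, the name under which this helper file is
attached to the crux item): closed disc exclusion, `r_{a'}(z) ≥ r₀ > 0` and `α² < a'² + r₀²` give
`r_α(z) > 0`. [cite: arXiv07060622, (35)] -/
theorem captureA_radius_pos : ∀ (a' α r₀ : ℝ) (z : E4), 0 < r₀ → r₀ ≤ Kerr.radius a' z → α ^ 2 < a' ^ 2 + r₀ ^ 2 → 0 < Kerr.radius α z :=
  fun _ _ _ _ hr₀ hz hα ↦ captureA_radius_pos_of_sq_lt hr₀ hz hα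

end Summit.FinalStateConjecture.FinalStateConjecture.Theorems

end
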